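import Mathlib
import Literature.NumberTheory.Sieve.MontgomeryVaughan1975Lemma43Blocks
import Literature.NumberTheory.LFunctions.ExplicitFormulaPsiCharProofs
import Summits.ValiantsHypothesis.ValiantsHypothesis.Theorems.LiouvilleSarnakAlignedTypeICharactersMod2nBilinearSieveZeroFreeTools
import HarnessLib

/-!
# Route LiouvilleSarnak — support `AlignedTypeI` (stmt-ValiantsHypothesis-21040), line `characters_mod_2n`:
# the window `log t ≍ log q` from a Postnikov–Gallagher-type zero-free region for `2`-power moduli

`…BilinearSieveTopConductor.lean` reduced the leaf `AlignedTypeI` to `H_Λ^window`: `‖ψ(t, χ)‖ ≤ η t` for primitive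
`χ (mod 2^j)` in the window `q^θ ≤ t ≤ q^{B}` (`q = 2^j → ∞`).  Here we derive the log-weighted form of that window
statement from a ZERO-FREE REGION HYPOTHESIS for the `L`-functions of primitive characters to `2`-power moduli
(hypothesis by arrow, no def):

  `HZ := ∀ A > 0 ∃ j₀ ∀ j ≥ j₀ ∀ χ primitive (mod 2^j) ∀ ρ, L(ρ, χ) = 0 → 0 < Re ρ < 1 → |Im ρ| ≤ j³ → Re ρ ≤ 1 − A log j / j`,

i.e. `(1 − β) log₂ q / log log₂ q → ∞` up to height `(log₂ q)³` — what the zero-free regions for powerful moduli of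
Postnikov (1956), Gallagher (Invent. Math. 16 (1972)) and Iwaniec (Invent. Math. 23 (1974)) give for `q = 2^j`
(`1 − β ≫ (log q)^{−2/3}(log log q)^{−1/3}` at such heights); NOT proved in the tree.  Everything else is PROVED in the tree:
MV I Thm 12.10 in block form (`MontgomeryVaughan1975.exists_block_bound_char` with `truncatedExplicitFormula_psiChar_holds`)
and the tools of `…BilinearSieveZeroFreeTools.lean`.

* `logWeightedPrimeCharSum_window_of_twoPowerZFR` — ★ `HZ →` for `θ, B, η > 0` and `j ≥ j₀`:
  `‖Σ_{p ≤ t} (log p) χ(p)‖ ≤ η t` whenever `θ j log 2 ≤ log t ≤ B j log 2` (`χ` primitive mod `2^j`).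

The assembly `HZ → AlignedTypeI` is `…BilinearSieveZeroFreeFinal.lean`.

HONEST FRAMING. Conditional by arrow on `HZ` (a classical-type but unproved input); the leaf `AlignedTypeI` is NOT closed;
nothing bears on `VP ≠ VNP` (NOT proved).
-/

set_option linter.dupNamespace false

noncomputable section

namespace Summit.ValiantsHypothesis.ValiantsHypothesis.Theorems.LiouvilleSarnak.AlignedTypeI.CharactersModTwoN

open Finset ArithmeticFunction
open scoped BigOperators
open Literature.NumberTheory.LFunctions
open Literature.NumberTheory.Sieve.MontgomeryVaughan1975 (charPrimeSum exists_block_bound_char)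

-- one long bookkeeping proof with a large context: the default heartbeat budget is too small
set_option maxHeartbeats 400000 in
/-- ★ **The window `θ j log 2 ≤ log t ≤ B j log 2` from a Postnikov–Gallagher-type zero-free region for `2`-power moduli**
(CONDITIONAL by arrow on `HZ`, see the module docstring).  Proof: MV I Thm 12.10 in block form on `(2, t]` at height
`T = j³` (`exists_block_bound_char`): `‖Σ_{2<p≤t} χ(p) log p‖ ≤ ‖Σ_{|γ|≤T} m(ρ)(t^ρ − 2^ρ)/ρ‖ + 2√t log t + 2 log(t+1)
+ K(log t + (t/T) log²(qtT))`; each zero contributes `≤ 2 t^β/β ≤ 2 t · j^{−6}/β_min` with `β ≤ 1 − A log j/j` (`HZ`,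
`A = 6/(θ log 2)`) and `β ≥ β_min ≫ 1/j` (`re_ge_of_LFunction_eq_zero_twoPower`), and there are `≪ j⁴` of them
(`sum_zeroOrder_box_le`); all error terms are `≪ t/j`. [folklore] -/
theorem logWeightedPrimeCharSum_window_of_twoPowerZFR
    (hZ : ∀ A : ℝ, 0 < A → ∃ j₀ : ℕ, ∀ j : ℕ, j₀ ≤ j → ∀ χ : DirichletCharacter ℂ (2 ^ j), χ.IsPrimitive →
      ∀ ρ : ℂ, χ.LFunction ρ = 0 → 0 < ρ.re → ρ.re < 1 → |ρ.im| ≤ (j : ℝ) ^ 3 →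
        ρ.re ≤ 1 - A * Real.log j / j) :
    ∀ th : ℝ, 0 < th → ∀ B : ℝ, 0 < B → ∀ η : ℝ, 0 < η → ∃ j₀ : ℕ, ∀ j : ℕ, j₀ ≤ j →
      ∀ χ : DirichletCharacter ℂ (2 ^ j), χ.IsPrimitive → ∀ t : ℕ,
        th * j * Real.log 2 ≤ Real.log t → Real.log t ≤ B * j * Real.log 2 →
          ‖∑ p ∈ (Finset.Iic t).filter Nat.Prime, (Real.log p : ℂ) * χ (p : ZMod (2 ^ j))‖ ≤ η * t := by
  classical
  obtain ⟨K, hK0, HK⟩ := exists_block_bound_char truncatedExplicitFormula_psiChar_holds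
  obtain ⟨C₀, hC₀, hcount⟩ := sum_zeroOrder_box_le
  obtain ⟨κ₁, hκ₁, hlow⟩ := re_ge_of_LFunction_eq_zero_twoPower
  intro th hth B hB η hη
  have hlog2 : 0 < Real.log 2 := Real.log_pos (by norm_num)
  have hlog2' := Real.log_two_gt_d9
  have hlog2'' := Real.log_two_lt_d9
  set A : ℝ := 6 / (th * Real.log 2) with hA
  have hA0 : 0 < A := by positivity
  obtain ⟨j₁, hj₁⟩ := hZ A hA0
  -- constants of the four error terms
  set D : ℝ := (B + 4) * Real.log 2 with hD
  have hD0 : 0 < D := by positivity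
  set CZ : ℝ := 144 * C₀ * Real.log 2 ^ 2 / κ₁ with hCZ
  have hCZ0 : 0 < CZ := by positivity
  set R : ℝ := 2 / th + |4 * Real.log (16 * (K + 6) / η)| / (th * Real.log 2) +
    |Real.log (44 / η + 1)| / (th * Real.log 2) + 4 * CZ / η + 4 * K * D ^ 2 / η + 2 with hR
  obtain ⟨j₂, hj₂⟩ : ∃ j₂ : ℕ, R ≤ j₂ := exists_nat_ge R
  refine ⟨max j₁ j₂, fun j hj χ hχ t hlo hhi => ?_⟩
  have hj₁j : j₁ ≤ j := le_trans (le_max_left _ _) hj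
  have hjR : R ≤ j := hj₂.trans (by exact_mod_cast le_trans (le_max_right _ _) hj)
  -- unpack the threshold `R ≤ j`
  have hR1 : 0 ≤ 2 / th := by positivity
  have hR2 : 0 ≤ |4 * Real.log (16 * (K + 6) / η)| / (th * Real.log 2) := by positivity
  have hR3 : 0 ≤ |Real.log (44 / η + 1)| / (th * Real.log 2) := by positivity
  have hR4 : 0 ≤ 4 * CZ / η := by positivity
  have hR5 : 0 ≤ 4 * K * D ^ 2 / η := by positivity
  have hj2 : (2 : ℝ) ≤ j := by linarith only [hjR, hR, hR1, hR2, hR3, hR4, hR5]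
  have hj2n : 2 ≤ j := by exact_mod_cast hj2
  have hj1n : 1 ≤ j := by omega
  have hj0 : (0 : ℝ) < j := by linarith only [hj2]
  have hthj : 2 ≤ th * j := by
    have h1 : 2 / th ≤ j := by linarith only [hjR, hR, hR1, hR2, hR3, hR4, hR5]
    have h2 := (div_le_iff₀ hth).mp h1
    linarith only [h2]
  have hthlog : 0 < th * Real.log 2 := by positivity
  have hthj2 : |4 * Real.log (16 * (K + 6) / η)| ≤ th * j * Real.log 2 := by
    have h1 : |4 * Real.log (16 * (K + 6) / η)| / (th * Real.log 2) ≤ j := by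
      linarith only [hjR, hR, hR1, hR2, hR3, hR4, hR5]
    have h2 := (div_le_iff₀ hthlog).mp h1
    linarith only [h2]
  have hthj3 : |Real.log (44 / η + 1)| ≤ th * j * Real.log 2 := by
    have h1 : |Real.log (44 / η + 1)| / (th * Real.log 2) ≤ j := by
      linarith only [hjR, hR, hR1, hR2, hR3, hR4, hR5]
    have h2 := (div_le_iff₀ hthlog).mp h1
    linarith only [h2]
  have hjCZ : 4 * CZ / η ≤ j := by linarith only [hjR, hR, hR1, hR2, hR3, hR4, hR5]
  have hjKD : 4 * K * D ^ 2 / η ≤ j := by linarith only [hjR, hR, hR1, hR2, hR3, hR4, hR5]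
  haveI : NeZero (2 ^ j) := ⟨pow_ne_zero _ two_ne_zero⟩
  have hq : 1 < 2 ^ j := Nat.one_lt_two_pow (by omega)
  have hne : χ ≠ 1 := ExplicitPsiChar.ne_one_of_isPrimitive hχ hq
  have hcast : ((2 ^ j : ℕ) : ℝ) = (2 : ℝ) ^ j := by norm_num
  have hlogq : Real.log ((2 : ℝ) ^ j) = j * Real.log 2 := by rw [Real.log_pow]
  obtain ⟨hlogj, hlogj35, hlog6⟩ := log_cube_add_five_le hj2n
  -- `t ≥ 4`, real facts
  set u : ℝ := Real.log t with hu
  have hu2 : 2 * Real.log 2 ≤ u := by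
    have h1 : 2 * Real.log 2 ≤ th * j * Real.log 2 := by nlinarith only [hthj, hlog2]
    linarith only [h1, hlo]
  have ht0 : (0 : ℝ) < t := by
    by_contra h
    have : (t : ℝ) = 0 := le_antisymm (not_lt.mp h) (Nat.cast_nonneg t)
    rw [hu, this, Real.log_zero] at hu2
    linarith only [hu2, hlog2]
  have ht4R : (4 : ℝ) ≤ t := by
    have h1 : Real.log 4 ≤ u := by
      rw [show (4 : ℝ) = 2 ^ 2 by norm_num, Real.log_pow]; push_cast; linarith only [hu2]
    exact (Real.log_le_log_iff (by norm_num) ht0).mp h1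
  have ht2 : 2 ≤ t := by exact_mod_cast (show (2 : ℝ) ≤ t by linarith only [ht4R])
  have ht1R : (1 : ℝ) ≤ t := by linarith only [ht4R]
  have hu0 : 0 < u := by linarith only [hu2, hlog2]
  have htexp : (t : ℝ) = Real.exp u := by rw [hu, Real.exp_log ht0]
  -- the level `T = j³`
  set T : ℝ := (j : ℝ) ^ 3 with hT
  have hT8 : 8 ≤ T := by
    have h := pow_le_pow_left₀ (by norm_num : (0:ℝ) ≤ 2) hj2 3
    rw [hT]; norm_num at h; linarith only [h]
  have hT2 : 2 ≤ T := by linarith only [hT8]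
  have hT0 : 0 < T := by linarith only [hT8]
  have hTj : T + 1 ≤ 2 * T := by linarith only [hT8]
  have hlogT : Real.log T = 3 * Real.log j := by rw [hT, Real.log_pow]; norm_num
  -- the block bound on `(2, t]`
  have hblock := HK (2 ^ j) hq χ hχ 2 t le_rfl ht2 T hT2
  -- (1) the zero sum is `≤ CZ t / j`
  set β₀ : ℝ := κ₁ / (6 * j * Real.log 2) with hβ₀
  have hβ₀0 : 0 < β₀ := by positivity
  have hj6 : Real.exp (6 * Real.log j) = (j : ℝ) ^ 6 := by
    rw [show 6 * Real.log (j : ℝ) = Real.log ((j : ℝ) ^ 6) by rw [Real.log_pow]; norm_num]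
    exact Real.exp_log (by positivity)
  have hj60 : (0 : ℝ) < (j : ℝ) ^ 6 := by positivity
  have hzeros : ∀ ρ ∈ (lfunctionZeroBox_finite hne T).toFinset,
      β₀ ≤ ρ.re ∧ (t : ℝ) ^ ρ.re ≤ t / (j : ℝ) ^ 6 := by
    intro ρ hρ
    have hρ' := hρ
    rw [Set.Finite.mem_toFinset, mem_lfunctionZeroBox] at hρ'
    obtain ⟨h0, hr0, hr1, him⟩ := hρ'
    have hle : ρ.re ≤ 1 - A * Real.log j / j := hj₁ j hj₁j χ hχ ρ h0 hr0 hr1 him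
    constructor
    · have h1 := hlow j hj1n χ hχ ρ h0 hr0 hr1
      refine le_trans ?_ h1
      rw [hβ₀]
      have hden : 0 < Real.log ((2 : ℝ) ^ j) + Real.log (|ρ.im| + 4) :=
        add_pos_of_nonneg_of_pos (by rw [hlogq]; positivity)
          (Real.log_pos (by linarith only [abs_nonneg ρ.im]))
      refine div_le_div_of_nonneg_left hκ₁.le hden ?_
      have h2 : Real.log (|ρ.im| + 4) ≤ Real.log ((j : ℝ) ^ 3 + 5) :=
        Real.log_le_log (by positivity) (by rw [hT] at him; linarith only [him])
      linarith only [h2, hlog6]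
    · have h1 : (t : ℝ) ^ ρ.re ≤ (t : ℝ) ^ (1 - A * Real.log j / j) :=
        Real.rpow_le_rpow_of_exponent_le ht1R hle
      have h2 : (t : ℝ) ^ (1 - A * Real.log j / j) = t * Real.exp (-(A * Real.log j / j * u)) := by
        rw [Real.rpow_def_of_pos ht0, ← hu,
          show u * (1 - A * Real.log j / j) = u + (-(A * Real.log j / j * u)) by ring,
          Real.exp_add, ← htexp]
      have h3 : 6 * Real.log j ≤ A * Real.log j / j * u := by
        have hlogj0 : 0 ≤ Real.log (j : ℝ) := Real.log_nonneg (by linarith)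
        have h4 : A * Real.log j / j * (th * j * Real.log 2) ≤ A * Real.log j / j * u :=
          mul_le_mul_of_nonneg_left hlo (by positivity)
        have h5 : A * Real.log j / j * (th * j * Real.log 2) = 6 * Real.log j := by
          rw [hA]; field_simp
        linarith only [h4, h5]
      have h4 : Real.exp (-(A * Real.log j / j * u)) ≤ ((j : ℝ) ^ 6)⁻¹ := by
        rw [← hj6, ← Real.exp_neg]
        exact Real.exp_le_exp.mpr (by linarith only [h3])
      calc (t : ℝ) ^ ρ.re ≤ t * Real.exp (-(A * Real.log j / j * u)) := by rw [← h2]; exact h1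
        _ ≤ t * ((j : ℝ) ^ 6)⁻¹ := mul_le_mul_of_nonneg_left h4 ht0.le
        _ = t / (j : ℝ) ^ 6 := by rw [div_eq_mul_inv]
  have hN : ∑ ρ ∈ (lfunctionZeroBox_finite hne T).toFinset, (DirichletDisc.zeroOrder χ ρ : ℝ) ≤
      C₀ * (2 * T) * (6 * j * Real.log 2) := by
    have h1 := hcount (2 ^ j) χ hχ hq T hT2 (lfunctionZeroBox_finite hne T).toFinset
      (fun ρ hρ => by rwa [Set.Finite.mem_toFinset] at hρ)
    rw [hcast] at h1
    refine h1.trans ?_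
    have h2 : Real.log ((2 : ℝ) ^ j) + Real.log (T + 5) ≤ 6 * j * Real.log 2 := by rw [hT]; exact hlog6
    have h3 : 0 ≤ Real.log ((2 : ℝ) ^ j) + Real.log (T + 5) := by
      have h4 : 0 ≤ Real.log ((2 : ℝ) ^ j) := by rw [hlogq]; positivity
      have h5 : 0 ≤ Real.log (T + 5) := Real.log_nonneg (by linarith only [hT8])
      linarith only [h4, h5]
    calc C₀ * (T + 1) * (Real.log ((2 : ℝ) ^ j) + Real.log (T + 5))
        ≤ C₀ * (2 * T) * (Real.log ((2 : ℝ) ^ j) + Real.log (T + 5)) :=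
          mul_le_mul_of_nonneg_right (mul_le_mul_of_nonneg_left hTj hC₀.le) h3
      _ ≤ C₀ * (2 * T) * (6 * j * Real.log 2) :=
          mul_le_mul_of_nonneg_left h2 (by positivity)
  have hzero : ‖charZeroSumTrunc χ (t : ℝ) T - charZeroSumTrunc χ ((2 : ℕ) : ℝ) T‖ ≤ CZ * t / j := by
    have h1 := norm_charZeroSumTrunc_sub_le hne (x := (t : ℝ)) (y := ((2 : ℕ) : ℝ)) (T := T)
      (by norm_num) (by exact_mod_cast ht2) hβ₀0 (by positivity) hzeros
    refine h1.trans ?_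
    calc 2 * (t / (j : ℝ) ^ 6) / β₀ * ∑ ρ ∈ (lfunctionZeroBox_finite hne T).toFinset,
          (DirichletDisc.zeroOrder χ ρ : ℝ)
        ≤ 2 * (t / (j : ℝ) ^ 6) / β₀ * (C₀ * (2 * T) * (6 * j * Real.log 2)) :=
          mul_le_mul_of_nonneg_left hN (by positivity)
      _ = CZ * t / j := by
          rw [hβ₀, hCZ, hT]
          field_simp
          ring
  -- (2) the primes `≤ 2` contribute at most `11`
  have hsmall : ‖∑ p ∈ (Finset.Iic 2).filter Nat.Prime, (Real.log p : ℂ) * χ (p : ZMod (2 ^ j))‖ ≤ 11 := by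
    have h1 := norm_logWeighted_le (fun n => χ (n : ZMod (2 ^ j))) (fun n => χ.norm_le_one _) 2
    refine h1.trans ?_
    have h4 : Real.log 4 = 2 * Real.log 2 := by
      rw [show (4 : ℝ) = 2 ^ 2 by norm_num, Real.log_pow]; norm_num
    rw [h4]; push_cast; linarith only [hlog2'']
  -- (3) the primes in `(2, t]` are the block sum
  have hbig : ∑ p ∈ (Finset.Ioc 2 t).filter Nat.Prime, (Real.log p : ℂ) * χ (p : ZMod (2 ^ j)) =
      charPrimeSum χ t (t - 2) := by
    have h22 : t - (t - 2) = 2 := by omega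
    rw [charPrimeSum, h22]
    exact Finset.sum_congr rfl fun p _ => mul_comm _ _
  -- (4) the error terms of the block bound
  have hlogt1 : Real.log ((t : ℝ) + 1) ≤ 2 * u := by
    have h1 : (t : ℝ) + 1 ≤ (t : ℝ) ^ 2 := by nlinarith only [ht4R]
    calc Real.log ((t : ℝ) + 1) ≤ Real.log ((t : ℝ) ^ 2) := Real.log_le_log (by positivity) h1
      _ = 2 * u := by rw [Real.log_pow, hu]; norm_num
  have hsqrt1 : 1 ≤ Real.sqrt t := by
    rw [show (1 : ℝ) = Real.sqrt 1 from (Real.sqrt_one).symm]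
    exact Real.sqrt_le_sqrt ht1R
  have herrA : 2 * Real.sqrt t * u + 2 * Real.log ((t : ℝ) + 1) + K * u ≤ (K + 6) * (Real.sqrt t * u) := by
    have h1 : u ≤ Real.sqrt t * u := by nlinarith only [hsqrt1, hu0]
    have hKu : K * u ≤ K * (Real.sqrt t * u) := mul_le_mul_of_nonneg_left h1 hK0
    linarith only [hlogt1, h1, hKu, hu0]
  -- `(K + 6) √t log t ≤ η t / 4`
  have herrA' : (K + 6) * (Real.sqrt t * u) ≤ η * t / 4 := by
    have hε : 0 < η / (K + 6) := by positivity
    have hw : 16 / (η / (K + 6)) ≤ Real.sqrt (Real.sqrt t) := by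
      have h16 : 16 / (η / (K + 6)) = 16 * (K + 6) / η := by field_simp
      rw [h16]
      have hpow : (16 * (K + 6) / η) ^ 4 ≤ (t : ℝ) := by
        have h1 : Real.log ((16 * (K + 6) / η) ^ 4) ≤ u := by
          rw [Real.log_pow]; push_cast
          linarith only [le_abs_self (4 * Real.log (16 * (K + 6) / η)), hthj2, hlo]
        exact (Real.log_le_log_iff (by positivity) ht0).mp h1
      have hs0 : 0 ≤ Real.sqrt (Real.sqrt (t : ℝ)) := Real.sqrt_nonneg _
      have hs4 : Real.sqrt (Real.sqrt (t : ℝ)) ^ 4 = (t : ℝ) := by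
        have h2 : Real.sqrt (Real.sqrt (t : ℝ)) ^ 2 = Real.sqrt (t : ℝ) := Real.sq_sqrt (Real.sqrt_nonneg _)
        calc Real.sqrt (Real.sqrt (t : ℝ)) ^ 4 = (Real.sqrt (Real.sqrt (t : ℝ)) ^ 2) ^ 2 := by ring
          _ = (t : ℝ) := by rw [h2, Real.sq_sqrt ht0.le]
      by_contra hlt
      rw [not_le] at hlt
      have : Real.sqrt (Real.sqrt (t : ℝ)) ^ 4 < (16 * (K + 6) / η) ^ 4 := pow_lt_pow_left₀ hlt hs0 (by norm_num)
      linarith only [this, hs4, hpow]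
    have h := two_sqrt_mul_log_le ht0 hε hw
    rw [← hu] at h
    have h2 : (K + 6) * (Real.sqrt t * u) = (K + 6) / 2 * (2 * Real.sqrt t * u) := by ring
    rw [h2]
    calc (K + 6) / 2 * (2 * Real.sqrt t * u) ≤ (K + 6) / 2 * (η / (K + 6) * t / 2) :=
          mul_le_mul_of_nonneg_left h (by positivity)
      _ = η * t / 4 := by field_simp; ring
  -- `K (t/T) log²(q t T) ≤ η t / 4`
  have herrB : K * ((t : ℝ) / T * Real.log (((2 ^ j : ℕ) : ℝ) * t * T) ^ 2) ≤ η * t / 4 := by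
    have hL : Real.log (((2 ^ j : ℕ) : ℝ) * t * T) ≤ D * j := by
      rw [hcast, Real.log_mul (by positivity) hT0.ne', Real.log_mul (by positivity) ht0.ne', hlogq, hlogT, hD]
      have hhi' : Real.log (t : ℝ) ≤ B * j * Real.log 2 := hhi
      linarith only [hhi', hlogj]
    have hL0 : 0 ≤ Real.log (((2 ^ j : ℕ) : ℝ) * t * T) := by
      rw [hcast]
      refine Real.log_nonneg ?_
      have h2j : (1 : ℝ) ≤ (2 : ℝ) ^ j := one_le_pow₀ (by norm_num)
      exact one_le_mul_of_one_le_of_one_le (one_le_mul_of_one_le_of_one_le h2j ht1R)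
        (by linarith only [hT2])
    have hL2 : Real.log (((2 ^ j : ℕ) : ℝ) * t * T) ^ 2 ≤ (D * j) ^ 2 := pow_le_pow_left₀ hL0 hL 2
    have h1 : K * ((t : ℝ) / T * Real.log (((2 ^ j : ℕ) : ℝ) * t * T) ^ 2) ≤ K * ((t : ℝ) / T * (D * j) ^ 2) :=
      mul_le_mul_of_nonneg_left (mul_le_mul_of_nonneg_left hL2 (by positivity)) hK0
    have h2 : K * ((t : ℝ) / T * (D * j) ^ 2) = (K * D ^ 2 / j) * t := by
      rw [hT]; field_simp
    have h3 : K * D ^ 2 / j ≤ η / 4 := by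
      rw [div_le_iff₀ hj0]
      have h4 := (div_le_iff₀ hη).mp hjKD
      linarith only [h4]
    calc K * ((t : ℝ) / T * Real.log (((2 ^ j : ℕ) : ℝ) * t * T) ^ 2) ≤ (K * D ^ 2 / j) * t := by rw [← h2]; exact h1
      _ ≤ η / 4 * t := mul_le_mul_of_nonneg_right h3 ht0.le
      _ = η * t / 4 := by ring
  -- `CZ t / j ≤ η t / 4` and `11 ≤ η t / 4`
  have herrC : CZ * t / j ≤ η * t / 4 := by
    have h3 : CZ / j ≤ η / 4 := by
      rw [div_le_iff₀ hj0]
      have h4 := (div_le_iff₀ hη).mp hjCZ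
      linarith only [h4]
    calc CZ * t / j = CZ / j * t := by ring
      _ ≤ η / 4 * t := mul_le_mul_of_nonneg_right h3 ht0.le
      _ = η * t / 4 := by ring
  have herrD : (11 : ℝ) ≤ η * t / 4 := by
    have h1 : Real.log (44 / η + 1) ≤ u := le_trans (le_abs_self _) (hthj3.trans hlo)
    have h2 : 44 / η + 1 ≤ t := by
      rw [htexp, ← Real.exp_log (show (0:ℝ) < 44 / η + 1 by positivity)]
      exact Real.exp_le_exp.mpr h1
    have h3 := (div_le_iff₀ hη).mp (show 44 / η ≤ t by linarith only [h2])
    linarith only [h3]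
  -- assembly
  rw [sum_primes_Iic_split _ ht2, hbig]
  have hbig_le : ‖charPrimeSum χ t (t - 2)‖ ≤ η * t / 4 + η * t / 4 + η * t / 4 := by
    have h1 : ‖charPrimeSum χ t (t - 2)‖ ≤
        ‖charPrimeSum χ t (t - 2) + (charZeroSumTrunc χ (t : ℝ) T - charZeroSumTrunc χ ((2 : ℕ) : ℝ) T)‖ +
          ‖charZeroSumTrunc χ (t : ℝ) T - charZeroSumTrunc χ ((2 : ℕ) : ℝ) T‖ := by
      have := norm_sub_le (charPrimeSum χ t (t - 2) +
        (charZeroSumTrunc χ (t : ℝ) T - charZeroSumTrunc χ ((2 : ℕ) : ℝ) T))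
        (charZeroSumTrunc χ (t : ℝ) T - charZeroSumTrunc χ ((2 : ℕ) : ℝ) T)
      rwa [add_sub_cancel_right] at this
    refine h1.trans ?_
    have h2 := add_le_add hblock hzero
    refine h2.trans ?_
    have h3 : 2 * Real.sqrt t * Real.log t + 2 * Real.log ((t : ℝ) + 1) +
        K * (Real.log t + (t : ℝ) / T * Real.log (((2 ^ j : ℕ) : ℝ) * t * T) ^ 2) =
        (2 * Real.sqrt t * u + 2 * Real.log ((t : ℝ) + 1) + K * u) +
          K * ((t : ℝ) / T * Real.log (((2 ^ j : ℕ) : ℝ) * t * T) ^ 2) := by rw [hu]; ring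
    rw [h3]
    linarith only [herrA, herrA', herrB, herrC]
  calc ‖∑ p ∈ (Finset.Iic 2).filter Nat.Prime, (Real.log p : ℂ) * χ (p : ZMod (2 ^ j)) + charPrimeSum χ t (t - 2)‖
      ≤ ‖∑ p ∈ (Finset.Iic 2).filter Nat.Prime, (Real.log p : ℂ) * χ (p : ZMod (2 ^ j))‖ +
          ‖charPrimeSum χ t (t - 2)‖ := norm_add_le _ _
    _ ≤ 11 + (η * t / 4 + η * t / 4 + η * t / 4) := add_le_add hsmall hbig_le
    _ ≤ η * t := by linarith only [herrD]

end Summit.ValiantsHypothesis.ValiantsHypothesis.Theorems.LiouvilleSarnak.AlignedTypeI.CharactersModTwoN
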